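import Literature.InformationTheory.QuantumLearning.PauliChannelEstimation
import HarnessLib

/-!
# Pauli twirling: the Pauli twirl of any channel is a Pauli channel with the same Pauli fidelities

Topic `Literature/InformationTheory/QuantumLearning`, sequel of `PauliChannelEstimation.lean` (the
`pauliChannel p` / `pauliEigenvalue p` vocabulary of Chen–Zhou–Seif–Jiang 2022 and Seif et al. 2026),
built on the tree's qubit-register Pauli vocabulary (`Pauli`, `pauliString`, `pauliCoeff`, the
commutation sign `strSign a b = (−1)^{⟨a,b⟩}`, its character orthogonality and the Pauli expansion,
`Literature/Computability/QuantumComplexity/Pauli*.lean`).  pub-qadeq lane (CLAIMS rows E-17 / E-44 /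
E-46 / E-47 — Pauli-noise error mitigation on IBM processors — and E-54, entanglement-enhanced
Pauli-channel learning): the ASSUMPTION "the noise is a Pauli channel" in those rows is justified in
print by Pauli twirling, and this file fixes, in the tree's vocabulary, exactly what twirling does.

HONEST FRAMING: instance-level adjudication of specific advantage claims; no claim about BQP vs BPP
or the summit.  Deterministic finite matrix identities only.  Nothing here says that any device's
noise is gate-independent or Markovian (the hypotheses under which twirling is exact in print), and
nothing is said about how well a finite sample of random twirls approximates the average.

## Where the rows invoke it (verbatim)

* E-17 [KimEtAl2023] p. 3 (Nature 618, 500; publisher PDF p. 3, L8–15): "The sparse Pauli–Lindblad noise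
  model proposed in ref. 1 … accurately captures the noise associated with layers of two-qubit
  Clifford gates, including crosstalk, when combined with random Pauli twirls [23,24]."  Its ref. 1 =
  [vandenBergMinevKandalaTemme2023], main text p. 1: "The noise channel `Λ_i` is specific to the gates
  in layer `i` and is assumed to be a Pauli channel. If needed, this can be ensured using Pauli
  twirling [22–26]".
* E-54 [SeifEtAl2026] p. 2 (arXiv:2408.03376v1 p. 2, L51–57): "Physically, Pauli channels describe a
  probabilistic mixture of Pauli operations. Their practical relevance is further motivated by the
  fact that arbitrary quantum channels can be transformed into Pauli channels through Pauli twirling,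
  which involves averaging over the application of random Pauli gates before and after the channel
  [29–31]"; Supplementary Note I (arXiv p. 16, L64–68): "We assume the ability to perform noiseless
  Pauli gates (or, less stringently, all Pauli gates have a gate-independent noise channel). … With
  this assumption, one can always twirl the noise channel into a Pauli channel. In the following, we
  assume the Pauli twirling has been done"; Fig. 3 caption (p. 5): "The gate is applied `d` times
  interleaved by twirling layers. Here, `d = 0, 16, 32`."

## Sources (verbatim) and what is formalised

[FlammiaWallman2020] S. T. Flammia, J. J. Wallman, *Efficient estimation of Pauli channels*, ACM
Trans. Quantum Comput. 1 (2020) 3 = arXiv:1907.12976, §2.2 (tex chunks p0008–p0009 of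
`lit read arxiv:1907.12976`): "For any `a,b ∈ 𝖯ⁿ`, `𝒫_a(P_b) = P_a P_b P_a† = (−1)^{⟨a,b⟩} P_b`. We will
partially characterize a general linear map by performing a Pauli twirl of the channel to reduce the
effective channel to a Pauli channel, that is, to a linear map with a Kraus representation
`𝓔(ρ) = Σ_{a∈𝖯ⁿ} p_a P_a ρ P_a` where the `p_a` are Pauli error rates with `p_a ≥ 0` for CP maps. For
any set `𝕋 ⊂ U(d)`, we define the `𝕋`-twirl of a channel `𝓛` to be
`𝓛^𝕋 = |𝕋|⁻¹ Σ_{T∈𝕋} 𝒯 𝓛 𝒯†`. … **Lemma 3 (Pauli error rates).** For a linear map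
`𝓛(M) = Σ_k A_k M B_k†` with Kraus operators `A_k = Σ_a l_{k,a} P_a` and `B_k = Σ_b r_{k,b} P_b`, the
Pauli error rates `p_a` of the twirled channel `𝓛^{𝖯ⁿ}` are given by `p_a = Σ_k l_{k,a} r*_{k,a}`."
(proof: "`𝓛^{𝖯ⁿ}(M) = |𝖯ⁿ|⁻¹ Σ_k Σ_{a,b,c} l_{k,a} r*_{k,b} (−1)^{⟨c,a+b⟩} P_a M P_b = Σ_k Σ_{a,b}
l_{k,a} r*_{k,b} 1[a=b] P_a M P_b`", by Lemma 1, the Pauli orthogonality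
`|𝖦|⁻¹ Σ_{b∈𝖦} (−1)^{⟨a,b⟩} = 1[a ∈ 𝖢_𝖦]`); "In the most important case of a CP map,
`l_{k,a} = r_{k,a}` and the error rates are manifestly nonnegative"; "the Pauli channel eigenvalues,
or just Pauli eigenvalues for short, which are defined as `𝐟 = W𝐩` … `𝓔 = Σ_a f_a |a)(a|`. With this
convention, `f_0 = Σ_a p_a ≤ 1` with equality if the channel is trace preserving, and all other
channel eigenvalues lie inside the interval `[−f_0, f_0]` if the channel is completely positive."

[vandenBergMinevKandalaTemme2023] E. van den Berg, Z. K. Minev, A. Kandala, K. Temme, *Probabilistic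
error cancellation with sparse Pauli–Lindblad models on noisy quantum processors*, Nat. Phys. 19
(2023) 1116 = arXiv:2201.09866, Supplementary Information §SII A "Noise channel simplification"
(arXiv PDF p. 9): "we can express `Λ̃` in terms of the Pauli transfer matrix `T_Λ̃` with entries
`T_Λ̃[a,b] = 2^{−n} Tr[P_a†(Λ̃(P_b))]`. … conjugation of the noise channel with randomly sampled
operators from the Pauli group results in an averaged channel `Λ(·) = E_i[P_i† Λ̃(P_i · P_i†) P_i]`
(S1), with a diagonal transfer matrix `T_Λ[a,b] = δ_{a,b} T_Λ̃[a,b]`. The averaging operation in (S1)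
is called a Pauli twirl. … The quantities on the diagonal of the transfer matrix represent the Pauli
fidelities `f_a = 2^{−n} Tr[P_a(Λ̃(P_a))]`. We can use the symplectic Walsh-Hadamard transformation
to convert these fidelities [28] to coefficients `c_b = … Σ_a (−1)^{⟨a,b⟩_sp} f_a` (S2) … These
coefficients allow us to then rewrite the noise operator applied to the density matrix `ρ` as a Pauli
channel: `Λ(ρ) = Σ_i c_i P_i ρ P_i†` (S3), where the vector `c = [c_i]` of all coefficients
represents a distribution: `c_i ≥ 0` and `Σ_i c_i = 1`."  (Normalisation note: with the sum in (S2)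
running over all `4ⁿ` labels the inverse symplectic Walsh–Hadamard transform carries the prefactor
`4^{−n}` — [ChenZhouSeifJiang2022, eq. (3)] `p_a = 4^{−n} Σ_b λ_b(−1)^{⟨a,b⟩}`, and
[FlammiaWallman2020, Lemma 4] `W†W = |𝖯ⁿ| Π`; the tree states that form, `walshHadamard_inversion`
of `PauliChannelEstimation.lean`, and so does `twirlRates` below.)

[WallmanEmerson2016] J. J. Wallman, J. Emerson, *Noise tailoring for scalable quantum computation via
randomized compiling*, Phys. Rev. A 94, 052325 (2016) = arXiv:1512.01098, proof of Theorem 1 (tex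
chunk p0005): "uniformly averaging over the twirling gates in every cycle reduces the noise in the
`k`th cycle to the tailored noise … When `𝕋 = ℙ`, the above channel is a Pauli channel [Emerson2007].
Moreover, by the definition of a unitary 1-design [Dankert2009], the above sum is independent of the
choice of `𝕋` and so is a Pauli channel for any unitary 1-design."  (Only the Pauli-group statement is
formalised here; the gate-dependent-noise robustness, ibid. Theorem 2, is not.)

## Contents (all proved, 0 named facts)

Conventions: the register is a finite type `ι` (`n = |ι|` qubits), operators are
`Matrix (ι → Bool) (ι → Bool) ℂ`, the `4ⁿ` Pauli strings `pauliString W` are Hermitian and square to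
`1` (so `P† = P` and FW's `𝒯 𝓛 𝒯†(M) = P 𝓛(P M P) P`); FW's normalised coefficients are
`l_{k,a} = 2^{−n} pauliCoeff (A k) a` (`pauliCoeff M a = Tr(P_a M)`).  A "map" `Λ` is any function
on operators; statements needing linearity take `Λ : _ →ₗ[ℂ] _`.

* `twirl Λ` — the Pauli twirl `Λ^𝖯(ρ) = 4^{−n} Σ_W P_W Λ(P_W ρ P_W) P_W` (FW §2.2; vdB (S1));
  `ptm Λ a b = 2^{−n} Tr(P_a Λ(P_b))` (vdB's transfer matrix) and `pauliFidelity Λ a = ptm Λ a a`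
  (vdB's `f_a`).
* `twirl_sandwich_self` / `twirl_sandwich_of_ne` — the core identity of FW's proof:
  the twirl of `ρ ↦ P_a ρ P_b` is itself if `a = b` and `0` otherwise (`4^{−n} Σ_c (−1)^{⟨c,a+b⟩} =
  1[a=b]`); `twirl_add` / `twirl_smul` / `twirl_sum` (linearity in the map).
* **`twirl_kraus`** — **FW Lemma 3** as printed: for `𝓛(ρ) = Σ_k A_k ρ B_k†`,
  `𝓛^𝖯 = pauliChannel p` with `p_a = 4^{−n} Σ_k Tr(P_a A_k) Tr(P_a B_k)^*` (`= Σ_k l_{k,a} r*_{k,a}`);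
  one pair: `twirl_mul_mul`.  **`twirl_kraus_cp`** — the CP case `B = A`: the rates are the manifestly
  nonnegative reals `twirlRate A a = 4^{−n} Σ_k |Tr(P_a A_k)|²` (`twirlRate_nonneg`), and
  **`sum_twirlRate`**: `Σ_a p_a = 1` when `Σ_k A_k† A_k = 1` (trace preserving) — vdB (S3) "`c_i ≥ 0`
  and `Σ_i c_i = 1`", FW "`f_0 = Σ_a p_a` … with equality if the channel is trace preserving";
  `twirl_unitary` / `sum_twirlRate_unitary` — one unitary Kraus operator (a coherent error becomes the
  stochastic Pauli channel with rates `4^{−n}|Tr(P_a U)|²`).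
* **`twirl_pauliString`** — for a linear `Λ`, `Λ^𝖯(P_a) = f_a P_a` with `f_a` the Pauli fidelity of
  the UNtwirled `Λ`; **`ptm_twirl`** — vdB (S1): "a diagonal transfer matrix
  `T_Λ[a,b] = δ_{a,b} T_Λ̃[a,b]`"; `pauliFidelity_twirl` (fidelities are twirl-invariant);
  **`twirl_eq_pauliChannel`** — vdB (S2)–(S3): `Λ^𝖯 = pauliChannel (twirlRates Λ)` with
  `twirlRates Λ a = 4^{−n} Σ_b f_b (−1)^{⟨a,b⟩}`, via `pauliEigenvalue_walshHadamard`
  (`W⁻¹` then `W` is the identity) and the Pauli expansion of `ρ`.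
* `twirl_pauliChannel` (Pauli channels are fixed by the twirl), `twirl_twirl` (idempotent),
  `twirl_self` (the identity map is fixed), `pauliFidelity_pauliChannel` (for a Pauli channel vdB's
  `f_a` is the tree's `pauliEigenvalue p a`, i.e. FW's `𝓔 = Σ_a f_a |a)(a|`).
* FW's two sentences on the eigenvalues: `pauliEigenvalue_const_I` (`f_0 = Σ_a p_a`) and
  `norm_pauliEigenvalue_le` (`|f_b| ≤ f_0` for nonnegative rates).
* Composition, as used by every depth-`d` protocol of the rows (Seif et al. Fig. 3: "applied `d`
  times interleaved by twirling layers"; Supplementary Note I: "Let `𝓔 := 𝓔^M ∘ 𝓔^S` be their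
  composition and denote the Pauli eigenvalue of `𝓔` as `ξ_a`"): `pauliChannel_pauliChannel_pauliString`
  (eigenvalues multiply), `pauliChannel_iterate_pauliString` (`Λ^d(P_a) = λ_a^d P_a`),
  `pauliFidelity_twirl_comp_twirl`.

## Not here

Twirls over other groups (Clifford / unitary 2-designs ⇒ depolarizing channels; local-Clifford twirls,
Seif et al. Methods), the randomized-compiling circuit construction and its robustness to
gate-dependent noise ([WallmanEmerson2016] Thms. 1–2), finite-sample approximation of the twirl, the
Haar-average gate fidelity and its relation to `f` (FW eq. after Lemma 4, [Magesan2012a] there), and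
anything about a particular device.  Mathlib has no quantum channels; the tree's `MixedState`/`pauliTwirl`
of `Literature/Barriers/QuantumAdvantage/NoiseThresholdUpperBounds.lean` is the one-WIRE twirl of a
STATE (`¼ Σ_Q σ_Q^{(j)} ρ σ_Q^{(j)} = (I/2) ⊗ Tr_j ρ`), a different object; `PauliPathOrthogonality.lean`
twirls read-outs/frames of a circuit (Aharonov et al. 2023), again not the channel twirl.  Searched:
`lean search 'twirl|pauliChannel|transferMatrix|randomizedCompil'` — no channel-twirling lemma in the
tree before this file.
-/

noncomputable section

open Matrix Finset

namespace Literature.InformationTheory.QuantumLearning.PauliTwirling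

open Literature.Computability.QuantumComplexity
open Literature.Computability.QuantumComplexity.PauliPath
open Literature.Computability.QuantumComplexity.OTOC
open Literature.InformationTheory.QuantumLearning.PauliChannelEstimation

variable {ι : Type*} [Fintype ι] [DecidableEq ι]

/-! ### Scalar and coefficient helpers -/

omit [DecidableEq ι] in
/-- `2ⁿ · 2ⁿ = 4ⁿ` (`|𝖯ⁿ| = d²`). [cite: FlammiaWallman2020, §2 ("d = 2ⁿ")] -/
private theorem two_pow_mul_two_pow :
    ((2 : ℂ) ^ Fintype.card ι) * (2 : ℂ) ^ Fintype.card ι = (4 : ℂ) ^ Fintype.card ι := by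
  rw [← mul_pow]; norm_num

/-- **Bilinear Pauli expansion** of a product `A X C`:
`A X C = 4^{−n} Σ_{a,b} Tr(P_a A) Tr(P_b C) · P_a X P_b` ("As the Pauli matrices are a Hermitian
orthogonal basis for `ℂ^{d×d}`, we can expand the Kraus operators as `A_k = Σ_a l_{k,a} P_a` and
`B_k = Σ_b r_{k,b} P_b`"). [cite: FlammiaWallman2020, §2.2 (proof of Lemma 3, first step)] -/
theorem mul_mul_eq_sum_sandwich (A X C : Matrix (ι → Bool) (ι → Bool) ℂ) :
    A * X * C = ((4 : ℂ) ^ Fintype.card ι)⁻¹ •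
      ∑ a : ι → Pauli, ∑ b : ι → Pauli, (pauliCoeff A a * pauliCoeff C b) •
        (pauliString a * X * pauliString b) := by
  conv_lhs => rw [eq_inv_smul_sum_pauliCoeff_smul A, eq_inv_smul_sum_pauliCoeff_smul C]
  simp only [Matrix.smul_mul, Matrix.mul_smul, Finset.sum_mul, Finset.mul_sum, Finset.smul_sum,
    smul_smul, ← two_pow_mul_two_pow, mul_inv]
  rw [Finset.sum_comm]
  refine Finset.sum_congr rfl fun a _ => Finset.sum_congr rfl fun b _ => ?_
  congr 1
  ring

/-- The Pauli coefficients of the adjoint: `Tr(P_b B†) = Tr(P_b B)^*` (the Pauli strings are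
Hermitian; this is the `r*_{k,b}` of `B_k† = Σ_b r*_{k,b} P_b`). [cite: FlammiaWallman2020, §2.2 (proof of Lemma 3)] -/
theorem pauliCoeff_conjTranspose (B : Matrix (ι → Bool) (ι → Bool) ℂ) (b : ι → Pauli) :
    pauliCoeff Bᴴ b = star (pauliCoeff B b) := by
  rw [pauliCoeff_eq, pauliCoeff_eq, ← Matrix.trace_conjTranspose, Matrix.conjTranspose_mul,
    conjTranspose_pauliString, Matrix.trace_mul_comm]

/-- `Tr(A† A) = Σ_{x,y} |A_{xy}|²` (Hilbert–Schmidt norm; used for "with equality if the channel is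
trace preserving"). [cite: FlammiaWallman2020, §2.2 ("(A|B) = Tr(A†B)")] -/
theorem trace_conjTranspose_mul_self (A : Matrix (ι → Bool) (ι → Bool) ℂ) :
    (Aᴴ * A).trace = ∑ x, ∑ y, (‖A x y‖ ^ 2 : ℂ) := by
  rw [Matrix.trace, Finset.sum_comm]
  refine Finset.sum_congr rfl fun y _ => ?_
  rw [Matrix.diag_apply, Matrix.mul_apply]
  refine Finset.sum_congr rfl fun x _ => ?_
  rw [Matrix.conjTranspose_apply, Complex.star_def, ← Complex.mul_conj', mul_comm]

/-- Conjugating by a Pauli string multiplies the `T`-th Pauli coefficient by the commutation sign: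
`Tr(P_T · P_W N P_W) = (−1)^{⟨W,T⟩} Tr(P_T N)` (`𝒫_a(P_b) = (−1)^{⟨a,b⟩} P_b`).
[cite: FlammiaWallman2020, §2.2 (display before the Pauli-channel definition)] -/
theorem pauliCoeff_conj (W : ι → Pauli) (N : Matrix (ι → Bool) (ι → Bool) ℂ) (T : ι → Pauli) :
    pauliCoeff (pauliString W * N * pauliString W) T = strSign W T * pauliCoeff N T := by
  rw [pauliCoeff_eq, pauliCoeff_eq, show pauliString T * (pauliString W * N * pauliString W) =
      (pauliString T * pauliString W * N) * pauliString W by simp only [Matrix.mul_assoc],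
    Matrix.trace_mul_comm, show pauliString W * (pauliString T * pauliString W * N) =
      (pauliString W * pauliString T * pauliString W) * N by simp only [Matrix.mul_assoc],
    pauliString_conj_eq_strSign_smul, Matrix.smul_mul, Matrix.trace_smul, smul_eq_mul]

/-- The Pauli coefficients of a Pauli string: `Tr(P_T P_S) = 2ⁿ [T = S]` ("`(a|b) = d⁻¹ Tr(P_a† P_b)
= δ_{a,b}`"). [cite: FlammiaWallman2020, §2.2 (normalisation `|a) = d^{−1/2}|P_a)`)] -/
theorem pauliCoeff_pauliString (S T : ι → Pauli) :
    pauliCoeff (pauliString S) T = if T = S then (2 : ℂ) ^ Fintype.card ι else 0 := by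
  rw [pauliCoeff_eq, trace_pauliString_mul_pauliString]

/-! ### The Pauli twirl of a map on `n`-qubit operators -/

/-- The (full, uniform) **Pauli twirl** of a map `Λ` on `n`-qubit operators:
`Λ^𝖯(ρ) = 4^{−n} Σ_{W ∈ 𝖯ⁿ} P_W Λ(P_W ρ P_W) P_W` — FW's `𝓛^𝕋 = |𝕋|⁻¹ Σ_T 𝒯 𝓛 𝒯†` for
`𝕋 =` the `4ⁿ` Pauli strings (Hermitian, so `𝒯†(ρ) = P ρ P`), vdB's (S1)
`Λ(·) = E_i[P_i† Λ̃(P_i · P_i†) P_i]`.  `Λ` is any function here; linearity is assumed where needed.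
[cite: FlammiaWallman2020, §2.2 (definition of the 𝕋-twirl)] [cite: vandenBergMinevKandalaTemme2023, SI §SII A eq. (S1)] -/
def twirl (Λ : Matrix (ι → Bool) (ι → Bool) ℂ → Matrix (ι → Bool) (ι → Bool) ℂ)
    (ρ : Matrix (ι → Bool) (ι → Bool) ℂ) : Matrix (ι → Bool) (ι → Bool) ℂ :=
  ((4 : ℂ) ^ Fintype.card ι)⁻¹ •
    ∑ W : ι → Pauli, pauliString W * Λ (pauliString W * ρ * pauliString W) * pauliString W

/-- Unfolding of `twirl`. [cite: FlammiaWallman2020, §2.2 (definition of the 𝕋-twirl)] -/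
theorem twirl_apply (Λ : Matrix (ι → Bool) (ι → Bool) ℂ → Matrix (ι → Bool) (ι → Bool) ℂ)
    (ρ : Matrix (ι → Bool) (ι → Bool) ℂ) :
    twirl Λ ρ = ((4 : ℂ) ^ Fintype.card ι)⁻¹ •
      ∑ W : ι → Pauli, pauliString W * Λ (pauliString W * ρ * pauliString W) * pauliString W := rfl

/-- The **Pauli transfer matrix** entry `T_Λ[a,b] = 2^{−n} Tr[P_a† Λ(P_b)]` of a map `Λ`
(`P_a† = P_a`). [cite: vandenBergMinevKandalaTemme2023, SI §SII A (definition of T_Λ̃[a,b])] -/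
def ptm (Λ : Matrix (ι → Bool) (ι → Bool) ℂ → Matrix (ι → Bool) (ι → Bool) ℂ) (a b : ι → Pauli) :
    ℂ :=
  ((2 : ℂ) ^ Fintype.card ι)⁻¹ * pauliCoeff (Λ (pauliString b)) a

/-- Unfolding of `ptm`. [cite: vandenBergMinevKandalaTemme2023, SI §SII A (definition of T_Λ̃[a,b])] -/
theorem ptm_eq (Λ : Matrix (ι → Bool) (ι → Bool) ℂ → Matrix (ι → Bool) (ι → Bool) ℂ)
    (a b : ι → Pauli) :
    ptm Λ a b = ((2 : ℂ) ^ Fintype.card ι)⁻¹ * pauliCoeff (Λ (pauliString b)) a := rfl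

/-- The **Pauli fidelity** `f_a = 2^{−n} Tr[P_a(Λ(P_a))]` of a map `Λ` — the diagonal entry
`T_Λ[a,a]` of its transfer matrix ("The quantities on the diagonal of the transfer matrix represent
the Pauli fidelities"). [cite: vandenBergMinevKandalaTemme2023, SI §SII A (f_a)] [cite: SeifEtAl2026, Methods §B ("the Pauli fidelities {λ_a} of Λ^P")] -/
def pauliFidelity (Λ : Matrix (ι → Bool) (ι → Bool) ℂ → Matrix (ι → Bool) (ι → Bool) ℂ)
    (a : ι → Pauli) : ℂ :=
  ptm Λ a a

/-- Unfolding of `pauliFidelity`: `f_a = 2^{−n} Tr(P_a Λ(P_a))`.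
[cite: vandenBergMinevKandalaTemme2023, SI §SII A (f_a)] -/
theorem pauliFidelity_eq (Λ : Matrix (ι → Bool) (ι → Bool) ℂ → Matrix (ι → Bool) (ι → Bool) ℂ)
    (a : ι → Pauli) :
    pauliFidelity Λ a = ((2 : ℂ) ^ Fintype.card ι)⁻¹ * pauliCoeff (Λ (pauliString a)) a := rfl

/-! ### The core identity: twirling a Pauli sandwich `ρ ↦ P_a ρ P_b` -/

/-- One term of the twirl of a sandwich: `P_W (P_a (P_W ρ P_W) P_b) P_W =
(−1)^{⟨W,a⟩}(−1)^{⟨W,b⟩} P_a ρ P_b` ("`𝒫_c(A_k) M 𝒫_c(B_k)†` … `(−1)^{⟨c,a+b⟩} P_a M P_b`").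
[cite: FlammiaWallman2020, §2.2 (proof of Lemma 3, first display line)] -/
theorem conj_sandwich_conj (W a b : ι → Pauli) (ρ : Matrix (ι → Bool) (ι → Bool) ℂ) :
    pauliString W * (pauliString a * (pauliString W * ρ * pauliString W) * pauliString b) *
        pauliString W = (strSign W a * strSign W b) • (pauliString a * ρ * pauliString b) := by
  rw [show pauliString W * (pauliString a * (pauliString W * ρ * pauliString W) * pauliString b) *
        pauliString W = (pauliString W * pauliString a * pauliString W) * ρ *
          (pauliString W * pauliString b * pauliString W) by simp only [Matrix.mul_assoc]]
  rw [pauliString_conj_eq_strSign_smul, pauliString_conj_eq_strSign_smul, Matrix.smul_mul,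
    Matrix.smul_mul, Matrix.mul_smul, smul_smul]

/-- Summing over the twirling Pauli: `Σ_W P_W (P_a (P_W ρ P_W) P_b) P_W = 4ⁿ [a = b] P_a ρ P_a`
("`Σ_c (−1)^{⟨c,a+b⟩} = |𝖯ⁿ| 1[a=b]`", Lemma 1 with `𝖢_{𝖯ⁿ} = 0`).
[cite: FlammiaWallman2020, §2.2 (proof of Lemma 3, second line) and Lemma 1] -/
theorem sum_conj_sandwich_conj (a b : ι → Pauli) (ρ : Matrix (ι → Bool) (ι → Bool) ℂ) :
    ∑ W : ι → Pauli, pauliString W * (pauliString a * (pauliString W * ρ * pauliString W) *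
        pauliString b) * pauliString W =
      if a = b then ((4 : ℂ) ^ Fintype.card ι) • (pauliString a * ρ * pauliString a) else 0 := by
  simp only [conj_sandwich_conj, ← Finset.sum_smul, sum_strSign_mul_strSign]
  split_ifs with h
  · subst h; rfl
  · rw [zero_smul]

/-- **The twirl fixes a matched sandwich**: `(ρ ↦ P_a ρ P_a)^𝖯 = (ρ ↦ P_a ρ P_a)`.
[cite: FlammiaWallman2020, §2.2 (proof of Lemma 3: the terms a = b survive)] -/
theorem twirl_sandwich_self (a : ι → Pauli) :
    twirl (fun ρ => pauliString a * ρ * pauliString a) =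
      fun ρ => pauliString a * ρ * pauliString a := by
  funext ρ
  have h4 : ((4 : ℂ) ^ Fintype.card ι) ≠ 0 := pow_ne_zero _ (by norm_num)
  simp only [twirl]
  rw [sum_conj_sandwich_conj, if_pos rfl, smul_smul, inv_mul_cancel₀ h4, one_smul]

/-- **The twirl kills a mismatched sandwich**: `(ρ ↦ P_a ρ P_b)^𝖯 = 0` for `a ≠ b` (the
off-diagonal `χ`-matrix elements average to zero).
[cite: FlammiaWallman2020, §2.2 (proof of Lemma 3: "1[a=b]")] -/
theorem twirl_sandwich_of_ne {a b : ι → Pauli} (h : a ≠ b) :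
    twirl (fun ρ => pauliString a * ρ * pauliString b) = 0 := by
  funext ρ
  simp only [twirl, Pi.zero_apply]
  rw [sum_conj_sandwich_conj, if_neg h, smul_zero]

/-- The identity map is fixed by the twirl (`P_W P_W = 1`; the case `a = b = 0` of the sandwich).
[cite: FlammiaWallman2020, §2.2 (proof of Lemma 3)] -/
theorem twirl_self :
    twirl (fun ρ : Matrix (ι → Bool) (ι → Bool) ℂ => ρ) = fun ρ => ρ := by
  funext ρ
  have h4 : ((4 : ℂ) ^ Fintype.card ι) ≠ 0 := pow_ne_zero _ (by norm_num)
  simp only [twirl]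
  have h := sum_conj_sandwich_conj (fun _ : ι => Pauli.I) (fun _ => Pauli.I) ρ
  simp only [pauliString_const_I, Matrix.one_mul, Matrix.mul_one, if_true] at h
  rw [h, smul_smul, inv_mul_cancel₀ h4, one_smul]

/-! ### Linearity of the twirl in the map -/

/-- The twirl is additive in the map. [cite: FlammiaWallman2020, §2.2 (𝓛^𝕋 is linear in 𝓛)] -/
theorem twirl_add (Λ₁ Λ₂ : Matrix (ι → Bool) (ι → Bool) ℂ → Matrix (ι → Bool) (ι → Bool) ℂ) :
    twirl (Λ₁ + Λ₂) = twirl Λ₁ + twirl Λ₂ := by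
  funext ρ
  simp only [twirl, Pi.add_apply, Matrix.mul_add, Matrix.add_mul, Finset.sum_add_distrib, smul_add]

/-- The twirl is homogeneous in the map. [cite: FlammiaWallman2020, §2.2 (𝓛^𝕋 is linear in 𝓛)] -/
theorem twirl_smul (c : ℂ)
    (Λ : Matrix (ι → Bool) (ι → Bool) ℂ → Matrix (ι → Bool) (ι → Bool) ℂ) :
    twirl (c • Λ) = c • twirl Λ := by
  funext ρ
  simp only [twirl, Pi.smul_apply, Matrix.mul_smul, Matrix.smul_mul, ← Finset.smul_sum, smul_comm c]

/-- The twirl of the zero map is zero. [cite: FlammiaWallman2020, §2.2 (𝓛^𝕋 is linear in 𝓛)] -/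
theorem twirl_zero :
    twirl (0 : Matrix (ι → Bool) (ι → Bool) ℂ → Matrix (ι → Bool) (ι → Bool) ℂ) = 0 := by
  funext ρ
  simp [twirl]

/-- The twirl commutes with finite sums of maps (twirl a Kraus sum term by term).
[cite: FlammiaWallman2020, §2.2 (eq. "In Kraus form, we have …")] -/
theorem twirl_sum {κ : Type*} (s : Finset κ)
    (Λ : κ → Matrix (ι → Bool) (ι → Bool) ℂ → Matrix (ι → Bool) (ι → Bool) ℂ) :
    twirl (∑ k ∈ s, Λ k) = ∑ k ∈ s, twirl (Λ k) := by
  classical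
  induction s using Finset.induction_on with
  | empty => simp [twirl_zero]
  | insert a s ha ih => rw [Finset.sum_insert ha, Finset.sum_insert ha, twirl_add, ih]

/-! ### Pauli channels as sums of rates (bookkeeping for `pauliChannel` of the sibling file) -/

/-- `pauliChannel` is additive in the rate vector. [cite: ChenZhouSeifJiang2022, eq. (1)] -/
theorem pauliChannel_add_rates (p q : (ι → Pauli) → ℂ) :
    (pauliChannel (p + q) : Matrix (ι → Bool) (ι → Bool) ℂ → Matrix (ι → Bool) (ι → Bool) ℂ) =
      pauliChannel p + pauliChannel q := by
  funext ρ
  simp only [pauliChannel_eq, Pi.add_apply, add_smul, Finset.sum_add_distrib]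

/-- The Pauli channel with zero rates is the zero map. [cite: ChenZhouSeifJiang2022, eq. (1)] -/
theorem pauliChannel_zero_rates :
    (pauliChannel (0 : (ι → Pauli) → ℂ) :
      Matrix (ι → Bool) (ι → Bool) ℂ → Matrix (ι → Bool) (ι → Bool) ℂ) = 0 := by
  funext ρ
  simp [pauliChannel_eq]

/-- `pauliChannel` commutes with finite sums of rate vectors. [cite: ChenZhouSeifJiang2022, eq. (1)] -/
theorem pauliChannel_sum_rates {κ : Type*} (s : Finset κ) (p : κ → (ι → Pauli) → ℂ) :
    (pauliChannel (∑ k ∈ s, p k) :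
      Matrix (ι → Bool) (ι → Bool) ℂ → Matrix (ι → Bool) (ι → Bool) ℂ) =
      ∑ k ∈ s, pauliChannel (p k) := by
  classical
  induction s using Finset.induction_on with
  | empty => simp [pauliChannel_zero_rates]
  | insert a s ha ih => rw [Finset.sum_insert ha, Finset.sum_insert ha, pauliChannel_add_rates, ih]

/-! ### Flammia–Wallman Lemma 3: the Pauli error rates of a twirled Kraus map -/

/-- **One Kraus pair**: the twirl of `ρ ↦ A ρ C` is the Pauli channel with rates
`p_a = 4^{−n} Tr(P_a A) Tr(P_a C)` (for `C = B†`: `Tr(P_a B†) = Tr(P_a B)^*`,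
`pauliCoeff_conjTranspose`, i.e. `p_a = l_a r_a^*` in FW's normalised coefficients).
[cite: FlammiaWallman2020, §2.2 Lemma 3 (proof)] -/
theorem twirl_mul_mul (A C : Matrix (ι → Bool) (ι → Bool) ℂ) :
    twirl (fun ρ => A * ρ * C) =
      pauliChannel (fun a => ((4 : ℂ) ^ Fintype.card ι)⁻¹ * (pauliCoeff A a * pauliCoeff C a)) := by
  funext ρ
  have h4 : ((4 : ℂ) ^ Fintype.card ι) ≠ 0 := pow_ne_zero _ (by norm_num)
  rw [twirl_apply, pauliChannel_eq]
  have hW : ∀ W : ι → Pauli,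
      pauliString W * (A * (pauliString W * ρ * pauliString W) * C) * pauliString W =
        ((4 : ℂ) ^ Fintype.card ι)⁻¹ • ∑ a : ι → Pauli, ∑ b : ι → Pauli,
          (pauliCoeff A a * pauliCoeff C b) •
            (pauliString W * (pauliString a * (pauliString W * ρ * pauliString W) *
              pauliString b) * pauliString W) := by
    intro W
    rw [mul_mul_eq_sum_sandwich A (pauliString W * ρ * pauliString W) C]
    simp only [Matrix.mul_smul, Matrix.smul_mul, Finset.mul_sum, Finset.sum_mul]
  simp only [hW, ← Finset.smul_sum, smul_smul]
  have hswap : ∑ W : ι → Pauli, ∑ a : ι → Pauli, ∑ b : ι → Pauli,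
      (pauliCoeff A a * pauliCoeff C b) •
        (pauliString W * (pauliString a * (pauliString W * ρ * pauliString W) * pauliString b) *
          pauliString W) =
      ∑ a : ι → Pauli, ∑ b : ι → Pauli, (pauliCoeff A a * pauliCoeff C b) •
        ∑ W : ι → Pauli, (pauliString W * (pauliString a * (pauliString W * ρ * pauliString W) *
          pauliString b) * pauliString W) := by
    rw [Finset.sum_comm]
    refine Finset.sum_congr rfl fun a _ => ?_
    rw [Finset.sum_comm]
    refine Finset.sum_congr rfl fun b _ => ?_
    rw [Finset.smul_sum]
  rw [hswap]
  simp only [sum_conj_sandwich_conj, smul_ite, smul_zero, Finset.sum_ite_eq, Finset.mem_univ,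
    if_true, smul_smul, Finset.smul_sum]
  refine Finset.sum_congr rfl fun a _ => ?_
  congr 1
  field_simp

/-- **Flammia–Wallman 2020, Lemma 3 (Pauli error rates), as printed.** For a linear map with Kraus
representation `𝓛(ρ) = Σ_k A_k ρ B_k†`, the Pauli twirl `𝓛^𝖯` is the Pauli channel
`Σ_a p_a P_a ρ P_a` with `p_a = Σ_k l_{k,a} r*_{k,a}`, where `A_k = Σ_a l_{k,a} P_a`,
`B_k = Σ_b r_{k,b} P_b`; in the tree's un-normalised coefficients `l_{k,a} = 2^{−n} Tr(P_a A_k)`, so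
`p_a = 4^{−n} Σ_k Tr(P_a A_k) Tr(P_a B_k)^*`. [cite: FlammiaWallman2020, §2.2 Lemma 3] -/
theorem twirl_kraus {κ : Type*} [Fintype κ] (A B : κ → Matrix (ι → Bool) (ι → Bool) ℂ) :
    twirl (fun ρ => ∑ k, A k * ρ * (B k)ᴴ) =
      pauliChannel (fun a => ((4 : ℂ) ^ Fintype.card ι)⁻¹ *
        ∑ k, pauliCoeff (A k) a * star (pauliCoeff (B k) a)) := by
  have hfun : (fun ρ : Matrix (ι → Bool) (ι → Bool) ℂ => ∑ k, A k * ρ * (B k)ᴴ) =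
      ∑ k, (fun ρ => A k * ρ * (B k)ᴴ) := by
    funext ρ; simp only [Finset.sum_apply]
  rw [hfun, twirl_sum]
  simp only [twirl_mul_mul, pauliCoeff_conjTranspose]
  rw [← pauliChannel_sum_rates]
  congr 1
  funext a
  simp only [Finset.sum_apply, Finset.mul_sum]

/-- The **Pauli error rates of the twirl of a completely positive map** `ρ ↦ Σ_k A_k ρ A_k†`:
`p_a = 4^{−n} Σ_k |Tr(P_a A_k)|²` (`= Σ_k |l_{k,a}|²`, "manifestly nonnegative"; independent of the
unitary freedom in the Kraus operators). [cite: FlammiaWallman2020, §2.2 Lemma 3 and the sentence after its proof] [cite: vandenBergMinevKandalaTemme2023, SI §SII A eq. (S3) (c_i)] -/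
def twirlRate {κ : Type*} [Fintype κ] (A : κ → Matrix (ι → Bool) (ι → Bool) ℂ) (a : ι → Pauli) :
    ℝ :=
  ((4 : ℝ) ^ Fintype.card ι)⁻¹ * ∑ k, ‖pauliCoeff (A k) a‖ ^ 2

/-- Unfolding of `twirlRate`. [cite: FlammiaWallman2020, §2.2 Lemma 3 (CP case)] -/
theorem twirlRate_eq {κ : Type*} [Fintype κ] (A : κ → Matrix (ι → Bool) (ι → Bool) ℂ)
    (a : ι → Pauli) :
    twirlRate A a = ((4 : ℝ) ^ Fintype.card ι)⁻¹ * ∑ k, ‖pauliCoeff (A k) a‖ ^ 2 := rfl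

/-- "In the most important case of a CP map, `l_{k,a} = r_{k,a}` and the error rates are manifestly
nonnegative" (vdB: "`c_i ≥ 0`"). [cite: FlammiaWallman2020, §2.2 (sentence after the proof of Lemma 3)] [cite: vandenBergMinevKandalaTemme2023, SI §SII A eq. (S3)] -/
theorem twirlRate_nonneg {κ : Type*} [Fintype κ] (A : κ → Matrix (ι → Bool) (ι → Bool) ℂ)
    (a : ι → Pauli) : 0 ≤ twirlRate A a :=
  mul_nonneg (inv_nonneg.2 (pow_nonneg (by norm_num) _))
    (Finset.sum_nonneg fun _ _ => sq_nonneg _)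

/-- **FW Lemma 3, CP case**: the Pauli twirl of `ρ ↦ Σ_k A_k ρ A_k†` is the Pauli channel with the
nonnegative rates `twirlRate A` — "the Pauli-twirled channel `𝓛^{𝖯ⁿ}` is a Pauli channel where the
error rates are directly related to the Kraus operators of the untwirled channel"; vdB (S3)
"`Λ(ρ) = Σ_i c_i P_i ρ P_i†`". [cite: FlammiaWallman2020, §2.2 Lemma 3] [cite: vandenBergMinevKandalaTemme2023, SI §SII A eqs. (S1), (S3)] [cite: WallmanEmerson2016, Theorem 1 (proof: "When 𝕋 = ℙ, the above channel is a Pauli channel")] -/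
theorem twirl_kraus_cp {κ : Type*} [Fintype κ] (A : κ → Matrix (ι → Bool) (ι → Bool) ℂ) :
    twirl (fun ρ => ∑ k, A k * ρ * (A k)ᴴ) = pauliChannel (fun a => (twirlRate A a : ℂ)) := by
  rw [twirl_kraus]
  congr 1
  funext a
  rw [twirlRate_eq]
  push_cast
  congr 1
  refine Finset.sum_congr rfl fun k _ => ?_
  rw [Complex.star_def, Complex.mul_conj']

/-- **Trace preservation gives a probability vector**: if `Σ_k A_k† A_k = 1` then `Σ_a p_a = 1`
("`f_0 = Σ_a p_a ≤ 1` with equality if the channel is trace preserving"; vdB "`Σ_i c_i = 1`").  Proof: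
Parseval `Σ_a |Tr(P_a A_k)|² = 2ⁿ Tr(A_k† A_k)` (`sum_norm_pauliCoeff_sq`) and `Tr 1 = 2ⁿ`.
[cite: FlammiaWallman2020, §2.2 (sentence after "𝓔 = Σ_a f_a |a)(a|")] [cite: vandenBergMinevKandalaTemme2023, SI §SII A eq. (S3)] -/
theorem sum_twirlRate {κ : Type*} [Fintype κ] {A : κ → Matrix (ι → Bool) (ι → Bool) ℂ}
    (hTP : ∑ k, (A k)ᴴ * A k = 1) : ∑ a, twirlRate A a = 1 := by
  have htr : (∑ k, ∑ x, ∑ y, ‖A k x y‖ ^ 2 : ℝ) = (2 : ℝ) ^ Fintype.card ι := by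
    have h := congrArg Matrix.trace hTP
    rw [Matrix.trace_sum, Matrix.trace_one, Fintype.card_fun, Fintype.card_bool] at h
    simp only [trace_conjTranspose_mul_self] at h
    exact_mod_cast h
  simp only [twirlRate_eq, ← Finset.mul_sum]
  rw [Finset.sum_comm]
  simp only [sum_norm_pauliCoeff_sq, ← Finset.mul_sum, htr]
  rw [show ((4 : ℝ) ^ Fintype.card ι) = 2 ^ Fintype.card ι * 2 ^ Fintype.card ι by
    rw [← mul_pow]; norm_num]
  have h2 : ((2 : ℝ) ^ Fintype.card ι) ≠ 0 := pow_ne_zero _ two_ne_zero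
  field_simp

/-- The twirl of a CP trace-preserving Kraus map preserves the trace (it is a Pauli channel with
rates summing to `1`; `trace_pauliChannel` of the sibling file). [cite: FlammiaWallman2020, §2.2 (f_0 = Σ_a p_a = 1 iff TP)] -/
theorem trace_twirl_kraus_cp {κ : Type*} [Fintype κ] {A : κ → Matrix (ι → Bool) (ι → Bool) ℂ}
    (hTP : ∑ k, (A k)ᴴ * A k = 1) (ρ : Matrix (ι → Bool) (ι → Bool) ℂ) :
    (twirl (fun ρ => ∑ k, A k * ρ * (A k)ᴴ) ρ).trace = ρ.trace := by
  rw [twirl_kraus_cp]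
  refine trace_pauliChannel _ ?_ ρ
  exact_mod_cast sum_twirlRate hTP

/-- **A coherent error becomes a stochastic Pauli channel**: the twirl of the unitary-conjugation map
`ρ ↦ U ρ U†` (one Kraus operator) is the Pauli channel with rates `4^{−n}|Tr(P_a U)|²`.
[cite: FlammiaWallman2020, §2.2 Lemma 3 (one Kraus operator, "CP maps with a single unitary Kraus operator U")] [cite: WallmanEmerson2016, Theorem 1 (proof)] -/
theorem twirl_unitary (U : Matrix (ι → Bool) (ι → Bool) ℂ) :
    twirl (fun ρ => U * ρ * Uᴴ) = pauliChannel (fun a => (twirlRate (fun _ : Unit => U) a : ℂ)) := by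
  rw [← twirl_kraus_cp]
  congr 1
  funext ρ
  simp

/-- The rates of `twirl_unitary`: `p_a = 4^{−n} |Tr(P_a U)|²`. [cite: FlammiaWallman2020, §2.2 Lemma 3 (one Kraus operator)] -/
theorem twirlRate_unique (U : Matrix (ι → Bool) (ι → Bool) ℂ) (a : ι → Pauli) :
    twirlRate (fun _ : Unit => U) a = ((4 : ℝ) ^ Fintype.card ι)⁻¹ * ‖pauliCoeff U a‖ ^ 2 := by
  simp [twirlRate_eq]

/-- For a unitary `U` (`U† U = 1`) the rates of `twirl_unitary` sum to `1`.
[cite: FlammiaWallman2020, §2.2 (f_0 = Σ_a p_a = 1 iff TP)] -/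
theorem sum_twirlRate_unitary {U : Matrix (ι → Bool) (ι → Bool) ℂ} (hU : Uᴴ * U = 1) :
    ∑ a, twirlRate (fun _ : Unit => U) a = 1 :=
  sum_twirlRate (by simpa using hU)

/-! ### The transfer-matrix form: twirling keeps the diagonal (van den Berg et al. (S1)–(S3)) -/

/-- For a linear `Λ` the twirl is additive in its argument.
[cite: vandenBergMinevKandalaTemme2023, SI §SII A eq. (S1)] -/
theorem twirl_map_add (Λ : Matrix (ι → Bool) (ι → Bool) ℂ →ₗ[ℂ] Matrix (ι → Bool) (ι → Bool) ℂ)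
    (ρ σ : Matrix (ι → Bool) (ι → Bool) ℂ) : twirl Λ (ρ + σ) = twirl Λ ρ + twirl Λ σ := by
  simp only [twirl_apply, Matrix.mul_add, Matrix.add_mul, map_add, Finset.sum_add_distrib, smul_add]

/-- For a linear `Λ` the twirl is homogeneous in its argument.
[cite: vandenBergMinevKandalaTemme2023, SI §SII A eq. (S1)] -/
theorem twirl_map_smul (Λ : Matrix (ι → Bool) (ι → Bool) ℂ →ₗ[ℂ] Matrix (ι → Bool) (ι → Bool) ℂ)
    (c : ℂ) (ρ : Matrix (ι → Bool) (ι → Bool) ℂ) : twirl Λ (c • ρ) = c • twirl Λ ρ := by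
  simp only [twirl_apply, Matrix.mul_smul, Matrix.smul_mul, map_smul, ← Finset.smul_sum, smul_comm c]

/-- For a linear `Λ` the twirl commutes with finite sums in its argument.
[cite: vandenBergMinevKandalaTemme2023, SI §SII A eq. (S1)] -/
theorem twirl_map_sum (Λ : Matrix (ι → Bool) (ι → Bool) ℂ →ₗ[ℂ] Matrix (ι → Bool) (ι → Bool) ℂ)
    {κ : Type*} (s : Finset κ) (ρ : κ → Matrix (ι → Bool) (ι → Bool) ℂ) :
    twirl Λ (∑ k ∈ s, ρ k) = ∑ k ∈ s, twirl Λ (ρ k) := by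
  classical
  induction s using Finset.induction_on with
  | empty =>
    simp only [Finset.sum_empty, twirl_apply, Matrix.mul_zero, Matrix.zero_mul, map_zero,
      Finset.sum_const_zero, smul_zero]
  | insert a s ha ih => rw [Finset.sum_insert ha, Finset.sum_insert ha, twirl_map_add, ih]

/-- **The Pauli strings are eigen-operators of the twirl, with the Pauli fidelities of the UNtwirled
map as eigenvalues**: `Λ^𝖯(P_a) = f_a P_a`, `f_a = 2^{−n} Tr[P_a Λ(P_a)]` ("The quantities on the
diagonal of the transfer matrix represent the Pauli fidelities").
[cite: vandenBergMinevKandalaTemme2023, SI §SII A eq. (S1) and the definition of f_a] -/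
theorem twirl_pauliString
    (Λ : Matrix (ι → Bool) (ι → Bool) ℂ →ₗ[ℂ] Matrix (ι → Bool) (ι → Bool) ℂ) (S : ι → Pauli) :
    twirl Λ (pauliString S) = pauliFidelity Λ S • pauliString S := by
  have h4 : ((4 : ℂ) ^ Fintype.card ι) ≠ 0 := pow_ne_zero _ (by norm_num)
  have h2 : ((2 : ℂ) ^ Fintype.card ι) ≠ 0 := pow_ne_zero _ two_ne_zero
  refine eq_of_forall_pauliCoeff_eq fun T => ?_
  rw [twirl_apply, pauliCoeff_smul, pauliCoeff_sum, pauliCoeff_smul, pauliFidelity_eq,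
    pauliCoeff_pauliString]
  have hW : ∀ W : ι → Pauli, pauliCoeff (pauliString W * Λ (pauliString W * pauliString S *
      pauliString W) * pauliString W) T =
        strSign W S * strSign W T * pauliCoeff (Λ (pauliString S)) T := by
    intro W
    rw [pauliString_conj_eq_strSign_smul, map_smul, Matrix.mul_smul, Matrix.smul_mul,
      pauliCoeff_smul, pauliCoeff_conj, mul_assoc]
  simp only [hW, ← Finset.sum_mul, sum_strSign_mul_strSign]
  by_cases hST : S = T
  · subst hST
    simp only [if_true]
    field_simp
  · rw [if_neg hST, if_neg (Ne.symm hST)]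
    simp

/-- **van den Berg et al. (S1): the twirl has "a diagonal transfer matrix
`T_Λ[a,b] = δ_{a,b} T_Λ̃[a,b]`"** — twirling projects the Pauli transfer matrix onto its diagonal.
[cite: vandenBergMinevKandalaTemme2023, SI §SII A eq. (S1)] -/
theorem ptm_twirl (Λ : Matrix (ι → Bool) (ι → Bool) ℂ →ₗ[ℂ] Matrix (ι → Bool) (ι → Bool) ℂ)
    (a b : ι → Pauli) :
    ptm (twirl Λ) a b = if a = b then ptm Λ a a else 0 := by
  have h2 : ((2 : ℂ) ^ Fintype.card ι) ≠ 0 := pow_ne_zero _ two_ne_zero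
  rw [ptm_eq, twirl_pauliString, pauliCoeff_smul, pauliCoeff_pauliString, pauliFidelity]
  by_cases hab : a = b
  · subst hab
    simp only [if_true]
    field_simp
  · simp [hab]

/-- **The Pauli fidelities are twirl-invariant**: `f_a(Λ^𝖯) = f_a(Λ)` (what a learning protocol run
on the twirled gate reports are the Pauli fidelities of the bare noise).
[cite: vandenBergMinevKandalaTemme2023, SI §SII A (S1)] [cite: SeifEtAl2026, Methods §B ("Let Λ^P be the Pauli twirled version of Λ. The ideal goal is to learn the Pauli fidelities {λ_a} of Λ^P")] -/
theorem pauliFidelity_twirl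
    (Λ : Matrix (ι → Bool) (ι → Bool) ℂ →ₗ[ℂ] Matrix (ι → Bool) (ι → Bool) ℂ) (a : ι → Pauli) :
    pauliFidelity (twirl Λ) a = pauliFidelity Λ a := by
  rw [pauliFidelity, ptm_twirl, if_pos rfl, pauliFidelity]

/-- For a Pauli channel the Pauli fidelity `f_a` (transfer-matrix diagonal) is the Pauli eigenvalue
`λ_a = Σ_b p_b(−1)^{⟨b,a⟩}` of the sibling file (FW: `𝓔 = Σ_a f_a |a)(a|`, `𝐟 = W𝐩`).
[cite: FlammiaWallman2020, §2.2 ("𝐟 = W𝐩" and "𝓔 = Σ_a f_a |a)(a|")] [cite: ChenZhouSeifJiang2022, eqs. (2)–(3)] -/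
theorem pauliFidelity_pauliChannel (p : (ι → Pauli) → ℂ) (a : ι → Pauli) :
    pauliFidelity (pauliChannel p) a = pauliEigenvalue p a := by
  have h2 : ((2 : ℂ) ^ Fintype.card ι) ≠ 0 := pow_ne_zero _ two_ne_zero
  rw [pauliFidelity_eq, pauliChannel_pauliString, pauliCoeff_smul, pauliCoeff_pauliString, if_pos rfl]
  field_simp

/-- **`W` after `W⁻¹` is the identity**: the Pauli eigenvalues of the rate vector
`a ↦ 4^{−n} Σ_b f_b (−1)^{⟨a,b⟩}` are the `f_b` themselves (Pauli orthogonality, FW Lemma 1 /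
Lemma 4 with `𝖠 = 𝖡 = 𝖯ⁿ`). [cite: FlammiaWallman2020, §2.2 Lemma 4 (W†W = |𝖯ⁿ| Π)] [cite: ChenZhouSeifJiang2022, eq. (3)] -/
theorem pauliEigenvalue_walshHadamard (f : (ι → Pauli) → ℂ) (S : ι → Pauli) :
    pauliEigenvalue (fun a => ((4 : ℂ) ^ Fintype.card ι)⁻¹ * ∑ b, f b * strSign a b) S = f S := by
  have h4 : ((4 : ℂ) ^ Fintype.card ι) ≠ 0 := pow_ne_zero _ (by norm_num)
  rw [pauliEigenvalue_eq]
  have hswap : ∑ a : ι → Pauli, (((4 : ℂ) ^ Fintype.card ι)⁻¹ * ∑ b, f b * strSign a b) *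
      strSign a S = ((4 : ℂ) ^ Fintype.card ι)⁻¹ *
        ∑ b : ι → Pauli, f b * ∑ a : ι → Pauli, strSign a b * strSign a S := by
    simp only [Finset.sum_mul, Finset.mul_sum]
    rw [Finset.sum_comm]
    refine Finset.sum_congr rfl fun b _ => Finset.sum_congr rfl fun a _ => ?_
    ring
  rw [hswap]
  simp only [sum_strSign_mul_strSign, mul_ite, mul_zero, Finset.sum_ite_eq', Finset.mem_univ,
    if_true]
  field_simp

/-- The **rates of the twirl of a linear map** from its Pauli fidelities: vdB (S2),
`c_a = 4^{−n} Σ_b (−1)^{⟨a,b⟩} f_b` (FW `𝐩 = W⁻¹𝐟`; normalisation as in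
[ChenZhouSeifJiang2022, eq. (3)], see the module docstring).
[cite: vandenBergMinevKandalaTemme2023, SI §SII A eq. (S2)] [cite: FlammiaWallman2020, §2.2 ("𝐩 = W⁻¹(𝟏 − 𝐫)")] -/
def twirlRates (Λ : Matrix (ι → Bool) (ι → Bool) ℂ → Matrix (ι → Bool) (ι → Bool) ℂ)
    (a : ι → Pauli) : ℂ :=
  ((4 : ℂ) ^ Fintype.card ι)⁻¹ * ∑ b, pauliFidelity Λ b * strSign a b

/-- Unfolding of `twirlRates`. [cite: vandenBergMinevKandalaTemme2023, SI §SII A eq. (S2)] -/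
theorem twirlRates_eq (Λ : Matrix (ι → Bool) (ι → Bool) ℂ → Matrix (ι → Bool) (ι → Bool) ℂ)
    (a : ι → Pauli) :
    twirlRates Λ a = ((4 : ℂ) ^ Fintype.card ι)⁻¹ * ∑ b, pauliFidelity Λ b * strSign a b := rfl

/-- **van den Berg et al. (S1)–(S3): the Pauli twirl of ANY linear map is the Pauli channel whose
rates are the symplectic Walsh–Hadamard transform of its Pauli fidelities**,
`Λ^𝖯(ρ) = Σ_a c_a P_a ρ P_a`, `c_a = 4^{−n} Σ_b (−1)^{⟨a,b⟩} f_b` (both sides are linear and agree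
on the Pauli basis: `twirl_pauliString`, `pauliChannel_pauliString`, `pauliEigenvalue_walshHadamard`).
[cite: vandenBergMinevKandalaTemme2023, SI §SII A eqs. (S1)–(S3)] [cite: SeifEtAl2026, p. 2 ("arbitrary quantum channels can be transformed into Pauli channels through Pauli twirling")] -/
theorem twirl_eq_pauliChannel
    (Λ : Matrix (ι → Bool) (ι → Bool) ℂ →ₗ[ℂ] Matrix (ι → Bool) (ι → Bool) ℂ) :
    twirl Λ = pauliChannel (twirlRates Λ) := by
  funext ρ
  rw [eq_inv_smul_sum_pauliCoeff_smul ρ, twirl_map_smul, pauliChannel_smul, twirl_map_sum,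
    pauliChannel_sum]
  congr 1
  refine Finset.sum_congr rfl fun T _ => ?_
  rw [twirl_map_smul, pauliChannel_smul, twirl_pauliString, pauliChannel_pauliString]
  congr 2
  exact (pauliEigenvalue_walshHadamard (pauliFidelity Λ) T).symm

/-- **Pauli channels are fixed points of the twirl**: `(Σ_a p_a P_a ρ P_a)^𝖯 = Σ_a p_a P_a ρ P_a`
(this is why a Pauli channel "is assumed" without loss after twirling).
[cite: vandenBergMinevKandalaTemme2023, main text p. 1 ("assumed to be a Pauli channel. If needed, this can be ensured using Pauli twirling")] [cite: FlammiaWallman2020, §2.2 Lemma 3 (A_k = B_k = √p_a P_a)] -/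
theorem twirl_pauliChannel (p : (ι → Pauli) → ℂ) : twirl (pauliChannel p) = pauliChannel p := by
  have h : (pauliChannel p : Matrix (ι → Bool) (ι → Bool) ℂ → Matrix (ι → Bool) (ι → Bool) ℂ) =
      ∑ S : ι → Pauli, p S • (fun ρ => pauliString S * ρ * pauliString S) := by
    funext ρ
    simp only [pauliChannel_eq, Finset.sum_apply, Pi.smul_apply]
  rw [h, twirl_sum]
  refine Finset.sum_congr rfl fun S _ => ?_
  funext ρ
  have h4 : ((4 : ℂ) ^ Fintype.card ι) ≠ 0 := pow_ne_zero _ (by norm_num)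
  simp only [twirl, Pi.smul_apply, Matrix.mul_smul, Matrix.smul_mul, ← Finset.smul_sum]
  rw [sum_conj_sandwich_conj, if_pos rfl, smul_smul, smul_smul]
  congr 1
  field_simp

/-- **The twirl is idempotent** on linear maps: `(Λ^𝖯)^𝖯 = Λ^𝖯`.
[cite: vandenBergMinevKandalaTemme2023, SI §SII A (S1)–(S3)] -/
theorem twirl_twirl (Λ : Matrix (ι → Bool) (ι → Bool) ℂ →ₗ[ℂ] Matrix (ι → Bool) (ι → Bool) ℂ) :
    twirl (twirl Λ) = twirl Λ := by
  rw [twirl_eq_pauliChannel Λ, twirl_pauliChannel]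

/-! ### Flammia–Wallman's two sentences on the eigenvalues of a Pauli channel -/

/-- "`f_0 = Σ_a p_a`": the eigenvalue of a Pauli channel at the identity string is the total rate
(`= 1` iff trace preserving). [cite: FlammiaWallman2020, §2.2 (sentence after "𝓔 = Σ_a f_a |a)(a|")] -/
theorem pauliEigenvalue_const_I (p : (ι → Pauli) → ℂ) :
    pauliEigenvalue p (fun _ => Pauli.I) = ∑ a, p a := by
  simp [pauliEigenvalue_eq, strSign_const_I]

/-- "all other channel eigenvalues lie inside the interval `[−f_0, f_0]` if the channel is completely
positive": for nonnegative rates, `|λ_b| ≤ Σ_a p_a`. [cite: FlammiaWallman2020, §2.2 (sentence after "𝓔 = Σ_a f_a |a)(a|")] -/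
theorem norm_pauliEigenvalue_le (p : (ι → Pauli) → ℝ) (hp : ∀ a, 0 ≤ p a) (b : ι → Pauli) :
    ‖pauliEigenvalue (fun a => (p a : ℂ)) b‖ ≤ ∑ a, p a := by
  rw [pauliEigenvalue_eq]
  refine (norm_sum_le _ _).trans (le_of_eq (Finset.sum_congr rfl fun a _ => ?_))
  have h1 : ‖strSign a b‖ = 1 := by
    rcases strSign_eq_one_or a b with h | h <;> simp [h]
  rw [norm_mul, h1, mul_one, Complex.norm_real, Real.norm_of_nonneg (hp a)]

/-! ### Composition: eigenvalues multiply (the depth-`d` decay of the rows' learning protocols) -/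

/-- **Eigenvalues of a composite of Pauli channels multiply**: `Λ_p(Λ_q(P_a)) = λ_a(p) λ_a(q) P_a`
("Let `𝓔 := 𝓔^M ∘ 𝓔^S` be their composition and denote the Pauli eigenvalue of `𝓔` as `ξ_a`").
[cite: SeifEtAl2026, Supplementary Note I (the composite 𝓔 = 𝓔^M ∘ 𝓔^S)] [cite: ChenZhouSeifJiang2022, eq. (2)] -/
theorem pauliChannel_pauliChannel_pauliString (p q : (ι → Pauli) → ℂ) (S : ι → Pauli) :
    pauliChannel p (pauliChannel q (pauliString S)) =
      (pauliEigenvalue p S * pauliEigenvalue q S) • pauliString S := by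
  rw [pauliChannel_pauliString, pauliChannel_smul, pauliChannel_pauliString, smul_smul, mul_comm]

/-- **Depth-`d` decay**: applying a Pauli channel `d` times multiplies `P_a` by `λ_a^d` (the
exponential decay fitted when "The gate is applied `d` times interleaved by twirling layers").
[cite: SeifEtAl2026, Fig. 3 caption and Methods §B] [cite: ChenZhouSeifJiang2022, eq. (2)] -/
theorem pauliChannel_iterate_pauliString (p : (ι → Pauli) → ℂ) (m : ℕ) (S : ι → Pauli) :
    (pauliChannel p)^[m] (pauliString S) = pauliEigenvalue p S ^ m • pauliString S := by
  induction m with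
  | zero => simp
  | succ m ih =>
    rw [Function.iterate_succ_apply', ih, pauliChannel_smul, pauliChannel_pauliString, smul_smul,
      pow_succ]

/-- Pauli fidelities of a composite of twirled maps multiply: `f_a(Λ₁^𝖯 ∘ Λ₂^𝖯) = f_a(Λ₁) f_a(Λ₂)`.
[cite: SeifEtAl2026, Supplementary Note I (composite of twirled channels) and Methods §B] -/
theorem pauliFidelity_twirl_comp_twirl
    (Λ₁ Λ₂ : Matrix (ι → Bool) (ι → Bool) ℂ →ₗ[ℂ] Matrix (ι → Bool) (ι → Bool) ℂ) (a : ι → Pauli) :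
    pauliFidelity (twirl Λ₁ ∘ twirl Λ₂) a = pauliFidelity Λ₁ a * pauliFidelity Λ₂ a := by
  have h2 : ((2 : ℂ) ^ Fintype.card ι) ≠ 0 := pow_ne_zero _ two_ne_zero
  rw [pauliFidelity_eq, Function.comp_apply, twirl_pauliString, twirl_map_smul, twirl_pauliString,
    smul_smul, pauliCoeff_smul, pauliCoeff_pauliString, if_pos rfl]
  field_simp

end Literature.InformationTheory.QuantumLearning.PauliTwirling
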